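import Literature.NumberTheory.EllipticCurves.SigmaSqDivisionBridgeProofs
import Literature.NumberTheory.EllipticCurves.FormalGroupDictionaryProofs
import Literature.NumberTheory.EllipticCurves.PadicSigmaConstantFormulaProofs
import HarnessLib

/-!
# The family of normalised odd formal solutions `σ_c` of the Mazur–Tate sigma equation over an ARBITRARY `ℚ`-algebra,
# and its functoriality under base change (step S6 glue of the discharge plan for the PRINT stub `stub_sigmaSqTwo`)

Cell `bsd-f1-sign2`, WIDTH-5 attach seat `bsd-line-att-p3` g8 (`--supports stmt-BirchSwinnertonDyer-23008`; plan
`Cruxes/BSDOfMainConjectureRankOneAtTwo/SIGMASQ-AT-TWO-att-p3.md`, §7/S6). THEOREMS ONLY; route-independent. BSD is not proved by any of this.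

WHY. The universal Dwork argument (S6) needs, over `K₂ = R̂₂[1/2]` (a `ℚ`-algebra DOMAIN, not a field, `Literature…PadicSigmaSqTwo.Universal.
completeRingQ`): (i) for the fixed-point constant `c ∈ R̂₂` (`…SigmaSqTwoConstantFixedPoint.lean`) a normalised odd solution `σ_c ∈ K₂⟦z⟧` of
`x + c = −D(Dσ/σ)` on the universal chart curve; (ii) that its base change along the Frobenius-type endomorphism `α` is the solution of the
`α`-twisted curve with constant `α(c)`. The tree has (i) over `ℚ_p` only (`exists_isFormallyOdd_satisfiesSigmaODE[_zero|_const]`,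
`SigmaSqDivisionBridgeProofs` / `X049CMSigmaSqTwoProofs` / `PerrinRiouCMSigma`); the ingredients (Blakestad–Grant's `σ = z·exp ∫(Λω − 1)/z` for a zeta
series, `PadicSigmaOfZetaProofs`, `PadicWeierstrassZetaProofs`, `PadicSigmaVariableChangeProofs`) are already stated over a `ℚ`-algebra. This file
re-runs the `ℚ_p` proofs verbatim over ANY `ℚ`-algebra `[CommRing K] [Algebra ℚ K]` and adds the (missing) base-change lemmas.

* §1 base change (any rings): `map_formalInvariantDerivation`, `map_logDeriv₂Num`, `isFormallyOdd_map_ringHom`; (`ℚ`-algebras)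
  `satisfiesSigmaODE_map_ringHom` — **`(σ, c)` a normalised solution on `V` ⇒ `(σ^φ, φ c)` one on `V^φ`.**
* §2 existence over a `ℚ`-algebra: `exists_isFormallyOdd_satisfiesSigmaODE_ratAlgebra` (some `c`), the twist
  `satisfiesSigmaODE_mul_exp_subst_ratAlgebra` / `isFormallyOdd_mul_exp_subst_ratAlgebra` (`σ·exp(ε log²)` has constant `c − 2ε`), and
  **`exists_isFormallyOdd_satisfiesSigmaODE_const_ratAlgebra : ∀ c, ∃ σ, σ(0) = 0 ∧ σ'(0) = 1 ∧ odd ∧ ODE(σ, c)`.**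

## Sources
B. Mazur, J. Tate, Duke Math. J. 62 (1991) §3; B. Mazur, W. Stein, J. Tate, Doc. Math. Extra Vol. Coates (2006), Thm. 1.3, §3.1 (the one-parameter
family of formal solutions) [cite: MazurSteinTate2006, Thm. 1.3]; C. Blakestad, D. Grant, J. Number Theory 249 (2023), Thm. 1, Thm. 2
[cite: BlakestadGrant2023, Thm. 1].
-/

noncomputable section

set_option linter.dupNamespace false
set_option autoImplicit false

open scoped Classical
open PowerSeries WeierstrassCurve Literature.NumberTheory.EllipticCurves Literature.RingTheory.FormalGroups

namespace Summit.BirchSwinnertonDyer.BirchSwinnertonDyer.Theorems.AlignedTransportAtTwoSigmaSqTwo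

/-! ## §1 Base change -/

section BaseChange

variable {R S : Type*} [CommRing R] [CommRing S] (φ : R →+* S) (W : WeierstrassCurve R)

/-- `D = η·d/dz` commutes with base change. [folklore] -/
theorem map_formalInvariantDerivation (g : R⟦X⟧) :
    PowerSeries.map φ (W.formalInvariantDerivation g) = (W.map φ).formalInvariantDerivation (PowerSeries.map φ g) := by
  rw [formalInvariantDerivation_apply, formalInvariantDerivation_apply, map_mul, map_formalEta, powerSeries_map_derivative]

/-- `N_D(g) = g·D²g − (Dg)²` commutes with base change. [folklore] -/
theorem map_logDeriv₂Num (g : R⟦X⟧) :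
    PowerSeries.map φ (logDeriv₂Num W.formalInvariantDerivation g) =
      logDeriv₂Num (W.map φ).formalInvariantDerivation (PowerSeries.map φ g) := by
  rw [logDeriv₂Num_def, logDeriv₂Num_def, map_sub, map_mul, map_pow, map_formalInvariantDerivation,
    map_formalInvariantDerivation]

variable {W} in
/-- **Mazur–Tate oddness is preserved by base change** (`i_{W^φ} = i_W^φ`). [cite: MazurSteinTate2006, Thm. 1.3] -/
theorem isFormallyOdd_map_ringHom {σ : R⟦X⟧} (h : W.IsFormallyOdd σ) :
    (W.map φ).IsFormallyOdd (PowerSeries.map φ σ) := by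
  unfold WeierstrassCurve.IsFormallyOdd at h ⊢
  rw [← map_formalNeg, ← Literature.NumberTheory.EllipticCurves.powerSeries_map_subst W.hasSubst_formalNeg φ σ, h,
    map_neg]

end BaseChange

section BaseChangeRat

variable {A B : Type*} [CommRing A] [CommRing B] [Algebra ℚ A] [Algebra ℚ B] (φ : A →+* B) (V : WeierstrassCurve A)

variable {V} in
/-- **The sigma equation is preserved by base change**: if `σ = z + ⋯` satisfies `x + c = −D(Dσ/σ)` on `V`, then `σ^φ` satisfies it on
`V^φ` with constant `φ(c)` (through the cleared form `z²·N_D(σ) = −(X + cz²)σ²`). [cite: MazurSteinTate2006, Thm. 1.3] -/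
theorem satisfiesSigmaODE_map_ringHom {σ : A⟦X⟧} {c : A} (hσ0 : constantCoeff σ = 0) (hσ1 : coeff 1 σ = 1)
    (h : V.SatisfiesSigmaODE σ c) : (V.map φ).SatisfiesSigmaODE (PowerSeries.map φ σ) (φ c) := by
  have h0 : constantCoeff (PowerSeries.map φ σ) = 0 := by
    rw [← coeff_zero_eq_constantCoeff_apply, coeff_map, coeff_zero_eq_constantCoeff_apply, hσ0, map_zero]
  have h1 : coeff 1 (PowerSeries.map φ σ) = 1 := by rw [coeff_map, hσ1, map_one]
  have hN := (satisfiesSigmaODE_iff_X_sq_mul_logDeriv₂Num hσ0 hσ1).mp h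
  rw [satisfiesSigmaODE_iff_X_sq_mul_logDeriv₂Num h0 h1, ← map_logDeriv₂Num, ← map_formalXMulSq]
  have e := congrArg (PowerSeries.map φ) hN
  rw [map_mul, map_pow, map_X, map_mul, map_neg, map_add, map_pow, map_mul, map_C, map_pow, map_X] at e
  exact e

end BaseChangeRat

/-! ## §2 Existence of the family `σ_c` over a `ℚ`-algebra -/

section Existence

variable {K : Type*} [CommRing K] [Algebra ℚ K] (V : WeierstrassCurve K)

/-- Positive integers are units of a `ℚ`-algebra. [folklore] -/
theorem isUnit_natCast_succ (k : ℕ) : IsUnit ((k + 1 : ℕ) : K) := by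
  have h : IsUnit ((k + 1 : ℕ) : ℚ) := isUnit_iff_ne_zero.mpr (Nat.cast_ne_zero.mpr k.succ_ne_zero)
  have := h.map (algebraMap ℚ K)
  rwa [map_natCast] at this

/-- The differential `x·ω` is formally exact over a `ℚ`-algebra: `k ∣ [z^{k+1}](X·W)` (for `k = 0`: `[z¹](X·W) = a₁ − a₁ = 0`). [folklore] -/
theorem natCast_dvd_coeff_succ_ratAlgebra (W : WeierstrassCurve K) (k : ℕ) :
    (k : K) ∣ coeff (k + 1) ((W.formalXMulSq - C (0 : K) * X ^ 2) * W.formalInvDiff) := by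
  rcases k with _ | k
  · rw [Nat.cast_zero, zero_dvd_iff, zero_add, map_zero, zero_mul, sub_zero, coeff_one_mul_eq,
      coeff_zero_eq_constantCoeff_apply, constantCoeff_formalXMulSq, coeff_one_formalInvDiff,
      coeff_one_formalXMulSq, coeff_zero_eq_constantCoeff_apply, constantCoeff_formalInvDiff]
    ring
  · exact (isUnit_natCast_succ k).dvd

/-- `2` is invertible in a `ℚ`-algebra. [folklore] -/
theorem isUnit_two_ratAlgebra : IsUnit (2 : K) := by
  have := isUnit_natCast_succ (K := K) 1
  norm_num at this
  exact this

/-- **Over a `ℚ`-algebra, every Weierstrass curve has, for SOME constant `c`, a normalised odd formal solution `σ = z + ⋯` of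
the sigma equation** (Blakestad–Grant's `σ = z·exp∫(Λω − 1)/z` on the `a₁ = a₃ = 0` model with an even zeta series, `β = 0`, transported back;
the tree's `exists_isFormallyOdd_satisfiesSigmaODE` verbatim with `ℚ_p` replaced by `K`). [cite: BlakestadGrant2023, Thm. 1] -/
theorem exists_isFormallyOdd_satisfiesSigmaODE_ratAlgebra :
    ∃ σ : K⟦X⟧, ∃ c : K, constantCoeff σ = 0 ∧ coeff 1 σ = 1 ∧ V.IsFormallyOdd σ ∧ V.SatisfiesSigmaODE σ c := by
  obtain ⟨u2, hu2⟩ := (isUnit_two_ratAlgebra (K := K)).exists_right_inv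
  haveI : Invertible (2 : K) := ⟨u2, by rw [mul_comm]; exact hu2, hu2⟩
  haveI := IsAddTorsionFree.of_module_rat (M := K)
  set V' := V.toCharNeTwoNF • V with hV'
  haveI : V'.IsCharNeTwoNF := V.toCharNeTwoNF_spec
  obtain ⟨Λ₀, h00, hΛ₀, -⟩ := V'.exists_padicWeierstrassZetaSeries (natCast_dvd_coeff_succ_ratAlgebra V')
  obtain ⟨hΛ, hc⟩ := zetaSeries_sub_C_mul_X hΛ₀ (coeff 1 Λ₀)
  set Λ := Λ₀ - C (coeff 1 Λ₀) * X with hΛdef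
  have h0 : constantCoeff Λ = 1 := hc.trans h00
  have h1 : coeff 1 Λ = 0 := by
    rw [hΛdef, map_sub, coeff_C_mul, coeff_one_X, mul_one, sub_self]
  have hΦ : rescale (-1 : K) ((V'.formalXMulSq - C (0 : K) * X ^ 2) * V'.formalInvDiff) =
      (V'.formalXMulSq - C (0 : K) * X ^ 2) * V'.formalInvDiff := by
    rw [map_zero, zero_mul, sub_zero, map_mul, V'.rescale_neg_one_formalXMulSq, V'.rescale_neg_one_formalInvDiff]
  have hev : rescale (-1 : K) Λ = Λ := rescale_neg_one_eq_self_of_zetaSeries hΛ hΦ h1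
  have hΛω : X * d⁄dX K Λ - Λ = -((V'.formalXMulSq - C (0 : K) * X ^ 2) * V'.formalOmega) := by
    rw [← formalInvDiff_eq_formalOmega]; exact hΛ
  have hσ'0 : constantCoeff (V'.sigmaOfZeta Λ) = 0 := V'.constantCoeff_sigmaOfZeta Λ
  have hσ'1 : coeff 1 (V'.sigmaOfZeta Λ) = 1 := V'.coeff_one_sigmaOfZeta Λ
  have hodd' : V'.IsFormallyOdd (V'.sigmaOfZeta Λ) := V'.isFormallyOdd_sigmaOfZeta hev
  have hODE' : V'.SatisfiesSigmaODE (V'.sigmaOfZeta Λ) (-0) := V'.satisfiesSigmaODE_sigmaOfZeta h0 hΛω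
  rw [hV'] at hodd' hODE' hσ'0 hσ'1
  refine ⟨C ((V.toCharNeTwoNF.u⁻¹ : Kˣ) : K) *
      ((V.toCharNeTwoNF • V).sigmaOfZeta Λ).subst (V.formalVariableChange V.toCharNeTwoNF),
    (V.toCharNeTwoNF.u : K) ^ 2 * (-0) - V.toCharNeTwoNF.r, ?_, ?_,
    hodd'.variableChange_subst _, hODE'.variableChange_subst hσ'0 hσ'1⟩
  · rw [map_mul, V.constantCoeff_subst_formalVariableChange V.toCharNeTwoNF hσ'0, mul_zero]
  · rw [coeff_C_mul, V.coeff_one_subst_formalVariableChange V.toCharNeTwoNF hσ'1, Units.inv_mul]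

/-- `ε·log_W²` has no constant term. [folklore] -/
theorem constantCoeff_C_mul_formalLog_sq_ratAlgebra (ε : K) : constantCoeff (C ε * V.formalLog ^ 2) = 0 := by
  rw [map_mul, map_pow, constantCoeff_formalLog, zero_pow two_ne_zero, mul_zero]

/-- `D exp(ε·log_W²) = 2ε·log_W·exp(ε·log_W²)`. [folklore] -/
theorem formalInvariantDerivation_exp_subst_ratAlgebra (ε : K) :
    V.formalInvariantDerivation ((exp K).subst (C ε * V.formalLog ^ 2)) =
      2 * C ε * V.formalLog * (exp K).subst (C ε * V.formalLog ^ 2) := by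
  have hg0 := constantCoeff_C_mul_formalLog_sq_ratAlgebra V ε
  have hηω : V.formalEta * V.formalOmega = 1 := V.formalEta_mul_formalOmega
  rw [formalInvariantDerivation_apply, derivative_exp_subst hg0, Derivation.leibniz, Derivation.leibniz_pow,
    derivative_C, derivative_formalLog, smul_zero, add_zero, smul_eq_mul, nsmul_eq_mul, Nat.cast_ofNat,
    Nat.add_one_sub_one, pow_one]
  linear_combination (2 * C ε * V.formalLog * (exp K).subst (C ε * V.formalLog ^ 2)) * hηω

/-- `exp(ε·log_W²)` is even: invariant under `z ↦ i(z)` (`log_W ∘ i = −log_W`). [folklore] -/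
theorem exp_subst_subst_formalNeg_ratAlgebra (ε : K) :
    PowerSeries.subst V.formalNeg ((exp K).subst (C ε * V.formalLog ^ 2)) = (exp K).subst (C ε * V.formalLog ^ 2) := by
  have hg0 := constantCoeff_C_mul_formalLog_sq_ratAlgebra V ε
  have hi := V.hasSubst_formalNeg
  rw [PowerSeries.subst_comp_subst_apply (PowerSeries.HasSubst.of_constantCoeff_zero' hg0) hi,
    subst_mul hi, subst_C, subst_pow hi, formalLog_subst_formalNeg, neg_sq]
  rfl

variable {V} in
/-- **Twist**: `(σ·exp(ε log_W²), c − 2ε)` is again a normalised solution when `(σ, c)` is (the tree's `SatisfiesSigmaODE.mul_exp_subst`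
over a `ℚ`-algebra). [cite: MazurSteinTate2006, Thm. 1.3] -/
theorem satisfiesSigmaODE_mul_exp_subst_ratAlgebra {σ : K⟦X⟧} {c : K} (hσ0 : constantCoeff σ = 0)
    (hσ1 : coeff 1 σ = 1) (h : V.SatisfiesSigmaODE σ c) (ε : K) :
    constantCoeff (σ * (exp K).subst (C ε * V.formalLog ^ 2)) = 0 ∧
      coeff 1 (σ * (exp K).subst (C ε * V.formalLog ^ 2)) = 1 ∧
      V.SatisfiesSigmaODE (σ * (exp K).subst (C ε * V.formalLog ^ 2)) (c - 2 * ε) := by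
  set E := (exp K).subst (C ε * V.formalLog ^ 2) with hE
  have hg0 := constantCoeff_C_mul_formalLog_sq_ratAlgebra V ε
  have hE0 : constantCoeff E = 1 := constantCoeff_exp_subst hg0
  have h0 : constantCoeff (σ * E) = 0 := by rw [map_mul, hσ0, zero_mul]
  have h1 : coeff 1 (σ * E) = 1 := by
    rw [coeff_one_mul_eq, coeff_zero_eq_constantCoeff_apply, hσ0, zero_mul, zero_add, hσ1,
      coeff_zero_eq_constantCoeff_apply, hE0, mul_one]
  refine ⟨h0, h1, ?_⟩
  have hN := (satisfiesSigmaODE_iff_X_sq_mul_logDeriv₂Num hσ0 hσ1).mp h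
  rw [satisfiesSigmaODE_iff_X_sq_mul_logDeriv₂Num h0 h1, logDeriv₂Num_mul, logDeriv₂Num_def _ E]
  have hDE : V.formalInvariantDerivation E = 2 * C ε * V.formalLog * E := formalInvariantDerivation_exp_subst_ratAlgebra V ε
  have hDlog : V.formalInvariantDerivation V.formalLog = 1 := by
    rw [formalInvariantDerivation_apply, derivative_formalLog, V.formalEta_mul_formalOmega]
  have hD2 : V.formalInvariantDerivation (2 : K⟦X⟧) = 0 := by
    rw [show (2 : K⟦X⟧) = ((2 : ℕ) : K⟦X⟧) by norm_cast]; exact Derivation.map_natCast _ 2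
  have hDDE : V.formalInvariantDerivation (V.formalInvariantDerivation E) =
      2 * C ε * E + (2 * C ε * V.formalLog) ^ 2 * E := by
    rw [hDE]
    simp only [Derivation.leibniz, smul_eq_mul, formalInvariantDerivation_C, hD2, hDlog, hDE]
    ring
  rw [hDDE, hDE, map_sub, map_mul, map_ofNat]
  linear_combination E ^ 2 * hN

variable {V} in
/-- Parity of the twist: `σ` odd ⇒ `σ·exp(ε log_W²)` odd. [cite: MazurSteinTate2006, Thm. 1.3] -/
theorem isFormallyOdd_mul_exp_subst_ratAlgebra {σ : K⟦X⟧} (h : V.IsFormallyOdd σ) (ε : K) :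
    V.IsFormallyOdd (σ * (exp K).subst (C ε * V.formalLog ^ 2)) := by
  unfold WeierstrassCurve.IsFormallyOdd at h ⊢
  rw [subst_mul V.hasSubst_formalNeg, h, exp_subst_subst_formalNeg_ratAlgebra V ε, neg_mul]

/-- **Over a `ℚ`-algebra the sigma equation `x + c = −D(Dσ/σ)` has a normalised ODD formal solution for EVERY constant `c`**
(twist the solution with constant `c₀` by `exp(((c₀ − c)/2)·log_W²)`). Applies to `K₂ = R̂₂[1/2]`.
[cite: MazurSteinTate2006, Thm. 1.3] -/
theorem exists_isFormallyOdd_satisfiesSigmaODE_const_ratAlgebra (c : K) :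
    ∃ σ : K⟦X⟧, constantCoeff σ = 0 ∧ coeff 1 σ = 1 ∧ V.IsFormallyOdd σ ∧ V.SatisfiesSigmaODE σ c := by
  obtain ⟨σ₀, c₀, h0, h1, hodd, hODE⟩ := exists_isFormallyOdd_satisfiesSigmaODE_ratAlgebra V
  obtain ⟨u2, hu2⟩ := (isUnit_two_ratAlgebra (K := K)).exists_right_inv
  obtain ⟨h0', h1', hODE'⟩ := satisfiesSigmaODE_mul_exp_subst_ratAlgebra h0 h1 hODE (u2 * (c₀ - c))
  refine ⟨_, h0', h1', isFormallyOdd_mul_exp_subst_ratAlgebra hodd (u2 * (c₀ - c)), ?_⟩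
  convert hODE' using 2
  linear_combination (c₀ - c) * hu2

end Existence

end Summit.BirchSwinnertonDyer.BirchSwinnertonDyer.Theorems.AlignedTransportAtTwoSigmaSqTwo
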